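import Literature.Analysis.FluidPDE.FracLaplacianHolder
import Literature.Analysis.FluidPDE.OnsagerBDSVGluedEnergy
import HarnessLib

/-!
# Energy balance of the fractional Navier–Stokes–Reynolds system and the dissipative term of
# De Rosa's gluing energy estimate (De Rosa 2019, Prop. 5.5, (5.18))

L. De Rosa, *Infinitely many Leray–Hopf solutions for the fractional Navier–Stokes equations*,
Comm. PDE 44 (2019) 335–365 = arXiv:1801.10235, §5.2, Prop. 5.5, estimate (5.18)
`|∫(|v̄_q|² - |v_ℓ|²)| ≲ δ_{q+1}ℓ^α`, whose proof "involves the structure of the dissipative term":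
"recall that `vᵢ` and `v_ℓ` are smooth solutions of (5.9) and (5.4) respectively, therefore
`|d/dt ∫(|vᵢ|² - |v_ℓ|²)| = 2|∫ ∇v_ℓ : R̊_ℓ| + 2ν|∫(|(-Δ)^{γ/2}vᵢ|² - |(-Δ)^{γ/2}v_ℓ|²)|`
… since `‖v_q‖_γ' ≤ 1` for every `γ' < β` …, by (5.10), Theorem 7.1 and Cauchy–Schwarz
inequality we have `|∫(|(-Δ)^{γ/2}vᵢ|² - |(-Δ)^{γ/2}v_ℓ|²)| ≲ ‖vᵢ - v_ℓ‖_{γ+α}`".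

This file proves the two inputs of that computation which are specific to the fractional system
(everything else is the Euler–Reynolds bookkeeping of `OnsagerBDSVGluedEnergy.lean`):

* `Torus.IsFracNSReynoldsOn.hasDerivWithinAt_energy` — **the energy balance**: for a smooth
  solution of `∂ₜv + (v·∇)v + ∇p + ν(-Δ)^γ v = div R`, `div v = 0` on `[a,b] × T^d` (`γ ≥ 0`),
  `d/dt ∫|v|² = -2∫∑ⱼ⟪R^{(j)}, ∂ⱼv⟫ - 2ν∫⟪(-Δ)^γ v, v⟫` (one-sided, within `[a,b]`); the fractional
  twin of `Torus.IsEulerReynoldsOn.hasDerivWithinAt_energy`;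
* `Torus.integral_inner_fracLaplacian_self_sub` — `∫⟪(-Δ)^γa, a⟫ - ∫⟪(-Δ)^γb, b⟫ =
  ∫⟪(-Δ)^γ(a + b), a - b⟫` (symmetry of `(-Δ)^γ`), and
  `Torus.exists_abs_integral_inner_fracLaplacian_self_sub_le` — **the dissipative difference**:
  for `0 < γ < 1` and `2γ < θ ≤ 1` there is `C` with
  `|∫⟪(-Δ)^γa, a⟫ - ∫⟪(-Δ)^γb, b⟫| ≤ C A sup‖a - b‖` whenever `a + b` has `θ`-Hölder constant `A`
  (Thm. 7.1 with `β = 0`, `Torus.exists_norm_fracLaplacian_le_of_holder`, in place of the paper's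
  Cor. 7.2 + Cauchy–Schwarz; either way the bound is `≲ ‖vᵢ - v_ℓ‖` times a Hölder seminorm above
  `2γ` resp. `γ` of the velocities, which the scheme keeps `≤ 1`).

## References

* L. De Rosa, Comm. PDE 44 (2019) 335–365 = arXiv:1801.10235, §5.2 Prop. 5.5 (5.18) and its
  proof (p. 14 of the arXiv text); §7 Thm. 7.1, Cor. 7.2. [`Derosa2018`]
* T. Buckmaster, C. De Lellis, L. Székelyhidi Jr., V. Vicol, CPAM 72 (2019) = arXiv:1701.08678,
  §4.5, proof of Prop. 4.4 (the Euler twin). [`BuckmasterEtAl2018`]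
-/

noncomputable section

open MeasureTheory Set Filter Topology Function
open scoped NNReal ENNReal ContDiff InnerProductSpace

namespace Literature.Analysis.FluidPDE

namespace Torus

open FunctionSpaces FunctionSpaces.Torus

variable {d : Type*} [Fintype d] [DecidableEq d]

/-! ## The energy balance of the fractional Navier–Stokes–Reynolds system -/

section Energy

variable {a b : ℝ} {γ ν : ℝ} {v : ℝ → UnitAddTorus d → EuclideanSpace ℝ d}
  {p : ℝ → UnitAddTorus d → ℝ} {R : ℝ → UnitAddTorus d → d → EuclideanSpace ℝ d}

/-- **Energy balance of the fractional Navier–Stokes–Reynolds system** (De Rosa 2019, proof of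
Prop. 5.5: "`|d/dt ∫(|vᵢ|² - |v_ℓ|²)| = 2|∫∇v_ℓ : R̊_ℓ| + 2ν|∫(|(-Δ)^{γ/2}vᵢ|² - |(-Δ)^{γ/2}v_ℓ|²)|`"):
for a smooth solution of `∂ₜv + (v·∇)v + ∇p + ν(-Δ)^γ v = div R`, `div v = 0` on `[a,b] × T^d`
(`a < b`, `γ ≥ 0`), `t ↦ ∫|v(t)|²` has one-sided derivative
`-2∫∑ⱼ⟪R^{(j)}(t), ∂ⱼv(t)⟫ - 2ν∫⟪(-Δ)^γ v(t), v(t)⟫` within `[a,b]` (the transport and pressure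
terms integrate to zero for divergence-free `v`; `∫⟪div R, v⟫ = -∫∑ⱼ⟪R^{(j)}, ∂ⱼv⟫`).
[cite: Derosa2018, §5.2 Prop. 5.5 (proof of (5.18))] -/
theorem IsFracNSReynoldsOn.hasDerivWithinAt_energy (h : IsFracNSReynoldsOn (Icc a b) γ ν v p R)
    (hab : a < b) (hγ : 0 ≤ γ) {t : ℝ} (ht : t ∈ Icc a b) :
    HasDerivWithinAt (fun s => ∫ x, ‖v s x‖ ^ 2)
      (-2 * (∫ x, ∑ j, ⟪R t x j, FunctionSpaces.Torus.partialDeriv j (v t) x⟫_ℝ) -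
        2 * ν * ∫ x, ⟪fracLaplacian γ (v t) x, v t x⟫_ℝ) (Icc a b) t := by
  classical
  have hU : UniqueDiffOn ℝ (Icc a b) := uniqueDiffOn_Icc hab
  have hv := h.smooth_velocity
  have hE : HasDerivWithinAt (fun s => ∫ x, ⟪v s x, v s x⟫_ℝ)
      (∫ x, FunctionSpaces.Torus.timeDerivWithin (Icc a b) (fun s y => ⟪v s y, v s y⟫_ℝ) t x) (Icc a b) t :=
    (hv.inner hv).hasDerivWithinAt_integral (convex_Icc a b) ht
  have hfun : (fun s => ∫ x, ‖v s x‖ ^ 2) = fun s => ∫ x, ⟪v s x, v s x⟫_ℝ := by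
    funext s
    exact integral_congr_ae (Eventually.of_forall fun x => (real_inner_self_eq_norm_sq (v s x)).symm)
  rw [hfun]
  convert hE using 1
  have hvt : FunctionSpaces.Torus.IsSmooth (v t) := hv.isSmooth_slice ht
  have hpt : FunctionSpaces.Torus.IsSmooth (p t) := h.smooth_pressure.isSmooth_slice ht
  have hRt : FunctionSpaces.Torus.IsSmooth (R t) := h.smooth_stress.isSmooth_slice ht
  have hLt : FunctionSpaces.Torus.IsSmooth (fracLaplacian γ (v t)) := hvt.fracLaplacian hγ
  have hpw : ∀ x, FunctionSpaces.Torus.timeDerivWithin (Icc a b) (fun s y => ⟪v s y, v s y⟫_ℝ) t x =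
      2 * ⟪FunctionSpaces.Torus.timeDerivWithin (Icc a b) v t x, v t x⟫_ℝ := by
    intro x
    rw [hv.timeDerivWithin_inner hv hU ht x, real_inner_comm (v t x)]
    ring
  have hmom : ∀ x, FunctionSpaces.Torus.timeDerivWithin (Icc a b) v t x =
      tensorDivergence (R t) x - FunctionSpaces.Torus.convect (v t) (v t) x -
        FunctionSpaces.Torus.gradient (p t) x - ν • fracLaplacian γ (v t) x := by
    intro x
    rw [← h.momentum t ht x]
    abel
  simp_rw [hpw, hmom]
  have i1 : Integrable (fun x => ⟪tensorDivergence (R t) x, v t x⟫_ℝ) volume :=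
    (hRt.tensorDivergence.inner hvt).integrable
  have i2 : Integrable (fun x => ⟪FunctionSpaces.Torus.convect (v t) (v t) x, v t x⟫_ℝ) volume :=
    ((hvt.convect hvt).inner hvt).integrable
  have i3 : Integrable (fun x => ⟪FunctionSpaces.Torus.gradient (p t) x, v t x⟫_ℝ) volume :=
    (hpt.gradient.inner hvt).integrable
  have i4 : Integrable (fun x => ⟪ν • fracLaplacian γ (v t) x, v t x⟫_ℝ) volume := by
    have h4 : Integrable (fun x => ⟪fracLaplacian γ (v t) x, v t x⟫_ℝ) volume := (hLt.inner hvt).integrable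
    simpa [real_inner_smul_left] using h4.const_mul ν
  have i12 : Integrable (fun x => ⟪tensorDivergence (R t) x, v t x⟫_ℝ -
      ⟪FunctionSpaces.Torus.convect (v t) (v t) x, v t x⟫_ℝ) volume := i1.sub i2
  have i123 : Integrable (fun x => ⟪tensorDivergence (R t) x, v t x⟫_ℝ -
      ⟪FunctionSpaces.Torus.convect (v t) (v t) x, v t x⟫_ℝ -
        ⟪FunctionSpaces.Torus.gradient (p t) x, v t x⟫_ℝ) volume := i12.sub i3
  simp_rw [inner_sub_left]
  rw [integral_const_mul, integral_sub i123 i4, integral_sub i12 i3, integral_sub i1 i2,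
    integral_inner_convect_eq_zero hvt hvt (h.divFree t ht),
    FunctionSpaces.Torus.integral_inner_gradient_eq_zero_of_isDivFree hvt hpt (h.divFree t ht),
    integral_inner_tensorDivergence hRt hvt]
  simp_rw [real_inner_smul_left]
  rw [integral_const_mul]
  ring

end Energy

/-! ## The dissipative difference `∫|(-Δ)^{γ/2}a|² - ∫|(-Δ)^{γ/2}b|²` -/

section Dissipation

omit [DecidableEq d] in
/-- Additivity of `(-Δ)^θ` on smooth fields (`θ ≥ 0`): `(-Δ)^θ(a + b) = (-Δ)^θ a + (-Δ)^θ b`. [folklore] -/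
theorem fracLaplacian_add [DecidableEq d] {θ : ℝ} (hθ : 0 ≤ θ) {a b : UnitAddTorus d → EuclideanSpace ℝ d}
    (ha : IsSmooth a) (hb : IsSmooth b) :
    fracLaplacian θ (fun x => a x + b x) = fun x => fracLaplacian θ a x + fracLaplacian θ b x := by
  have h := fracLaplacian_sub hθ (show IsSmooth (fun x => a x + b x) from ha.add hb) hb
  have h2 : (fun x => a x + b x - b x) = a := by
    funext x; abel
  rw [h2] at h
  funext x
  have hx : fracLaplacian θ a x = fracLaplacian θ (fun y => a y + b y) x - fracLaplacian θ b x :=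
    congr_fun h x
  rw [hx, sub_add_cancel]

/-- **The dissipative difference as a single pairing**: for smooth `a, b` and `θ ≥ 0`,
`∫⟪(-Δ)^θ a, a⟫ - ∫⟪(-Δ)^θ b, b⟫ = ∫⟪(-Δ)^θ(a + b), a - b⟫` (bilinearity and the symmetry
`∫⟪(-Δ)^θ u, w⟫ = ∫⟪u, (-Δ)^θ w⟫`, `Torus.integral_inner_fracLaplacian_comm`). [folklore] -/
theorem integral_inner_fracLaplacian_self_sub {θ : ℝ} (hθ : 0 ≤ θ)
    {a b : UnitAddTorus d → EuclideanSpace ℝ d} (ha : IsSmooth a) (hb : IsSmooth b) :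
    (∫ x, ⟪fracLaplacian θ a x, a x⟫_ℝ) - ∫ x, ⟪fracLaplacian θ b x, b x⟫_ℝ =
      ∫ x, ⟪fracLaplacian θ (fun y => a y + b y) x, a x - b x⟫_ℝ := by
  have hLa : IsSmooth (fracLaplacian θ a) := ha.fracLaplacian hθ
  have hLb : IsSmooth (fracLaplacian θ b) := hb.fracLaplacian hθ
  have iaa : Integrable (fun x => ⟪fracLaplacian θ a x, a x⟫_ℝ) volume := (hLa.inner ha).integrable
  have iab : Integrable (fun x => ⟪fracLaplacian θ a x, b x⟫_ℝ) volume := (hLa.inner hb).integrable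
  have iba : Integrable (fun x => ⟪fracLaplacian θ b x, a x⟫_ℝ) volume := (hLb.inner ha).integrable
  have ibb : Integrable (fun x => ⟪fracLaplacian θ b x, b x⟫_ℝ) volume := (hLb.inner hb).integrable
  -- the cross terms agree
  have hcross : ∫ x, ⟪fracLaplacian θ b x, a x⟫_ℝ = ∫ x, ⟪fracLaplacian θ a x, b x⟫_ℝ := by
    rw [integral_inner_fracLaplacian_comm hθ hb ha]
    refine integral_congr_ae (Eventually.of_forall fun x => ?_)
    exact real_inner_comm _ _
  have hexp : (fun x => ⟪fracLaplacian θ (fun y => a y + b y) x, a x - b x⟫_ℝ) = fun x =>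
      (⟪fracLaplacian θ a x, a x⟫_ℝ - ⟪fracLaplacian θ a x, b x⟫_ℝ) +
        (⟪fracLaplacian θ b x, a x⟫_ℝ - ⟪fracLaplacian θ b x, b x⟫_ℝ) := by
    funext x
    rw [fracLaplacian_add hθ ha hb]
    simp only [inner_add_left, inner_sub_right]
    ring
  have i1' : Integrable (fun x => ⟪fracLaplacian θ a x, a x⟫_ℝ - ⟪fracLaplacian θ a x, b x⟫_ℝ) volume :=
    iaa.sub iab
  have i2' : Integrable (fun x => ⟪fracLaplacian θ b x, a x⟫_ℝ - ⟪fracLaplacian θ b x, b x⟫_ℝ) volume :=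
    iba.sub ibb
  rw [hexp, integral_add i1' i2', integral_sub iaa iab, integral_sub iba ibb, hcross]
  ring

/-- **The dissipative difference is controlled by `‖a - b‖₀` and a Hölder seminorm of `a + b` above
`2γ`** (De Rosa, proof of (5.18): "`|∫(|(-Δ)^{γ/2}vᵢ|² - |(-Δ)^{γ/2}v_ℓ|²)| ≲ ‖vᵢ - v_ℓ‖_{γ+α}`",
there by Cor. 7.2 and Cauchy–Schwarz; here by Thm. 7.1 with `β = 0`): for `0 < γ < 1` and
`2γ < θ ≤ 1` there is `C = C(γ, θ, d)` such that for smooth `a, b : T^d → ℝ^d` with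
`‖(a + b)(proj y) - (a + b)(proj z)‖ ≤ A‖y - z‖^θ` and `‖a x - b x‖ ≤ D` for all `x`:
`|∫⟪(-Δ)^γ a, a⟫ - ∫⟪(-Δ)^γ b, b⟫| ≤ C A D` (the torus has volume one).
[cite: Derosa2018, §5.2 Prop. 5.5 (proof of (5.18))] -/
theorem exists_abs_integral_inner_fracLaplacian_self_sub_le (d : Type*) [Fintype d] [DecidableEq d]
    {γ : ℝ} (hγ0 : 0 < γ) (hγ1 : γ < 1) {θ : ℝ} (hθ : 2 * γ < θ) (hθ1 : θ ≤ 1) :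
    ∃ C : ℝ, 0 ≤ C ∧ ∀ {a b : UnitAddTorus d → EuclideanSpace ℝ d}, IsSmooth a → IsSmooth b →
      ∀ {A : ℝ}, 0 ≤ A →
        (∀ y z : EuclideanSpace ℝ d, ‖(a (proj y) + b (proj y)) - (a (proj z) + b (proj z))‖ ≤
          A * ‖y - z‖ ^ θ) →
        ∀ {D : ℝ}, (∀ x, ‖a x - b x‖ ≤ D) →
          |(∫ x, ⟪fracLaplacian γ a x, a x⟫_ℝ) - ∫ x, ⟪fracLaplacian γ b x, b x⟫_ℝ| ≤ C * A * D := by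
  obtain ⟨C, hC0, hC⟩ := exists_norm_fracLaplacian_le_of_holder d hγ0 hγ1 hθ hθ1
  refine ⟨C, hC0, ?_⟩
  intro a b ha hb A hA hH D hD
  have hab : IsSmooth (fun x => a x + b x) := ha.add hb
  have hsup : ∀ x, ‖fracLaplacian γ (fun y => a y + b y) x‖ ≤ C * A := hC hab hA hH
  have hD0 : 0 ≤ D := (norm_nonneg _).trans (hD 0)
  rw [integral_inner_fracLaplacian_self_sub hγ0.le ha hb]
  have hpt : ∀ x, ‖⟪fracLaplacian γ (fun y => a y + b y) x, a x - b x⟫_ℝ‖ ≤ C * A * D := by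
    intro x
    rw [Real.norm_eq_abs]
    calc |⟪fracLaplacian γ (fun y => a y + b y) x, a x - b x⟫_ℝ|
        ≤ ‖fracLaplacian γ (fun y => a y + b y) x‖ * ‖a x - b x‖ := abs_real_inner_le_norm _ _
      _ ≤ (C * A) * D := mul_le_mul (hsup x) (hD x) (norm_nonneg _) (mul_nonneg hC0 hA)
      _ = C * A * D := by ring
  have h := norm_integral_le_of_norm_le_const (μ := (volume : Measure (UnitAddTorus d))) (C := C * A * D)
    (Eventually.of_forall hpt)
  rw [Real.norm_eq_abs] at h
  simpa using h

end Dissipation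

end Torus

end Literature.Analysis.FluidPDE
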